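import Summits.QuantumFields.YangMills.Theorems.BalabanUVNodesN11CompatibleInitialSegmentSplit
import Summits.QuantumFields.YangMills.Theorems.BalabanUVNodesN11OneBlockTailHistories
import Summits.QuantumFields.YangMills.Theorems.BalabanUVNodesK0BgProvisoRangedAtEmptySeq
import Literature.MathematicalPhysics.QuantumFieldTheory.Balaban1983to89.Node00.Sect2RegionGeometry

/-!
# DAG node N11 — def-R's RANGED BACKGROUND PROVISO `BgProvisoΛ` ON THE ONE-BLOCK TAIL: its per-`(s, 𝐖, j, X)` clause is VACUOUS at a dead level (`Ω_j = Λ_j = ∅`), is EXACTLY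
# the `spaceMS`-membership at the switch level (`Ω_j = T`, `Λ_j = ∅`: every domain meets `Ω_j` and `Z̃_j = T`), and EXACTLY the `spaceI`-membership at an all-small level (`Λ_j = T`:
# every domain lies in `Λ_j`, none meets `Z̃_j = ∅`) — so the token up to a level `k` SPLITS into the token up to the last compatible level `n₀` plus, on the one-block tail, a
# GLOBAL-REGULARITY supplier at all-small levels and a LARGE-FIELD-SPACE supplier at switch levels; nothing is asked at dead levels

HEADER — WORK-UNIT METADATA.  Cell `pub-ymgap`, YM-PLAN Track A (HUMAN RULING D-0062 ∕ D-0149 width seats), seat `pub-ymgap-dag-n11-w4` (g5; WIDTH SEAT 4 of 4 on NODE n11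
[B14]), route `BalabanUVNodes` rev 29, deciding item K1⁹ `StabilityBRunRowsAtRecordR13SepCoPHV` = stmt-QuantumFields-27364 (helper lane, `--kind proof --supports 27364 --as helper`,
count-neutral).  [III] = [Balaban1988Convergent], [I] = [Balaban1987RG1].  Over def-R's `Node00.BgProvisoΛ` (`BgProvisoRangedOfRecord`: the (2.26)–(2.28) ∕ (2.41)(i)-ranged background
proviso = K0's row P11 `bg` = the `hbgs ∕ hob` binders of dag-n11-w1's bg-facts road), dag-n21-c's `K0BgProvisoOverRange.domSites_nonempty` (a localization domain has a site), 11b's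
`Sect2.admB_eq_true_iff` ∕ `Node00.Sect2.subset_enlT`, p618164 `…N11OneBlockLevels` (`∅ ∕ T` at a one-block level), and this seat's p633302 `…N11CompatibleInitialSegmentSplit` (the split `n₀`)
and p634387 `…N11OneBlockTailHistories` (`allSmall_below_of_Λ_eq_univ`, `dead_above_of_Λ_eq_empty`).

WHY THIS FILE.  On dag-n11-w1 g4's SPLIT bg supply (`…N11NodeFaceOfSplitBgSupplierBorel`, CLAIM-6 12:59Z) the guarded row P11 serves the compatible prefix `k ≤ n₀` and a displayed
ONE-BLOCK PRODUCER `hob : ∀ k ≤ K, sitesPerDir 0 < dCubeSide … k → BgProvisoΛ … k …` serves the top segment.  What does `BgProvisoΛ` actually ask on the tail?  Its clause at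
`(s, 𝐖, j, X)` is «`domSites X ⊆ Λ_j(s) → U ∈ spaceI(X)`» ∧ «`X ∩ Ω_j(s) ≠ ∅ ∧ X ∩ Z̃_j(s) ≠ ∅ → U ∈ spaceMS(X, Ω(s))`» ([III] (2.27)–(2.28), (2.41)(i); `Z̃_j = (Λ_jᶜ)^∼`).  At a
ONE-BLOCK level `j` every history has `Ω_j, Λ_j ∈ {∅, T}` (p618164), so (§1): DEAD (`∅, ∅`) ⇒ both antecedents fail (a domain is non-empty — dag-n21-c) ⇒ the clause is FREE; SWITCH
(`T, ∅`) ⇒ the `spaceI` half is free and the `spaceMS` antecedent HOLDS for every domain (`Z̃_j ⊇ Λ_jᶜ = T`) ⇒ the clause IS `U ∈ spaceMS(X, Ω)`; ALL-SMALL (`Λ_j = T`) ⇒ the `spaceMS`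
half is free (`Z̃_j = ∅^∼ = ∅`) and the `spaceI` antecedent holds for every domain ⇒ the clause IS `U ∈ spaceI(X)` — regularity of the background on EVERY localization domain of the
torus, i.e. of the GLOBAL small-field background (N07's [B11] Thm 1 regime, as this seat's RUN-GUARD memo located).  Hence (§2) the token up to `k` is the token up to any `n₀ ≤ k`
plus exactly these two suppliers on the levels `n₀ < j ≤ k` when those are one-block; (§3) along a windowed (2.6)-run `n₀` is p633302's last compatible level.  On the TAIL LEVELS `hob`
therefore reads: «global regularity at the all-small levels + the large-field space at the switch level» — and nothing at dead levels; its clauses at the PREFIX levels `j ≤ n₀` (for the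
same history family — print's regime, domains inside genuinely varying `Λ_j(s)`) stay as displayed (`hpre` below; NOT reduced here, and NOT the guarded row at a shorter length unless the
background of record restricts along truncation — a def-R property this file does not use).

WHAT THIS FILE PROVES (0 `sorry`, 0 `def`; standard axioms; set theory on def-R's token, nothing of its analytic content).
§1 `enlT_empty` · `inter_enlT_univ_nonempty` · ★★ `bgClause_of_dead` · ★★ `bgClause_iff_spaceMS_of_switch` · ★★ `bgClause_iff_spaceI_of_allSmall`.
§2 `bgProvisoΛ_iff_prefix_and_tail` (any `n₀ ≤ k`: the token splits level-wise) · ★★★ `bgProvisoΛ_of_prefix_of_oneBlockTail` (prefix token + one-block tail + an all-small `spaceI`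
   supplier + a switch `spaceMS` supplier ⟹ the token up to `k`) · ★★★ `bgProvisoΛ_of_prefix_of_oneBlockTail'` (the suppliers TOLD THE WHOLE STAIRCASE: all-small at every level
   `≤ j`, resp. all-small below `j`, `(T,∅)` at `j`, dead above — one history shape per level) · ★★ `bgClause_of_init_of_dead` (the PREFIX clauses of a dead-topped history come from
   the shorter family: `Ω_{n+1}(s) = ∅`, `U s = U′ (init s)`, `Supp s ⊆ Supp′ (init s)` ⟹ every clause at `s` from the length-`n` token) · ★★ `spaceI_of_bgProvisoΛ_of_allSmall` ∕ `spaceMS_of_bgProvisoΛ_of_switch` (conversely the token CONTAINS both suppliers).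
§3 ★★★ `bgProvisoΛ_of_prefix_of_suppliers_of_flowIneq26` (generic θ, `M = L^a`, `r = 1`, window, (2.6), `0 ≤ β⁺`, `β⁺γ² ≤ 1`: the token up to any `k ≤ K` for histories over the run's
   `𝐃` of record from the token up to p633302's `n₀` and the two tail suppliers).

HONEST FRAMING.  Helper lane of K1⁹; count-neutral set-theoretic bookkeeping on def-R's DISPLAYED token (its `spaceI` ∕ `spaceMS` memberships — [III] (2.28) ∕ [15] Thm 1 content — are
HYPOTHESES here, asserted by nobody); nothing of Bałaban asserted; NOT a discharge.  N11 NOT discharged; K1⁹ NOT closed, no registered stub of v9 touched; counts unmoved (typed 28∕28 ·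
discharged 5∕27 · A 5∕28).  One finite `𝕋⁴_{L^K}` programme at fixed `ε = L^{−K}`; R4 closes only the conditional finite-𝕋⁴ rung `BalabanLadder.UV` — NOT ℝ⁴, NOT OS, NOT a mass gap, NOT
Clay.  No `sorry`, `axiom`, `def`, `instance`, `notation`.  Sources (SHAPE ∕ bookkeeping only): [III] (2.26)–(2.28) p.259, (2.30) p.260, (2.41)(i) p.261, (2.1)–(2.3) pp.254–255, (2.17) p.257,
(2.6) p.255; [I] (1.11)–(1.16) pp.261–262 (the space `U^c_j`), (0.1) p.251.
-/

noncomputable section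

open scoped Matrix.Norms.L2Operator

namespace Summit.QuantumFields.YangMills.Theorems.BalabanUVNodesN11BgProvisoOnOneBlockTail

open Literature.MathematicalPhysics.QuantumFieldTheory.Balaban1983to89 T4Continuum Node00 B14.Eq218Concrete
open Summit.QuantumFields.YangMills.Theorems.K0BgProvisoOverRange (domSites_nonempty)
open BalabanUVNodesN11OneBlockLevels (eq_empty_or_eq_univ_of_mem_unionsOfCubes_of_le)
open BalabanUVNodesN11CompatibleInitialSegmentSplit (exists_lastCompatibleLevel_of_window_of_flowIneq26)
open BalabanUVNodesN11OneBlockTailHistories (allSmall_below_of_Λ_eq_univ dead_above_of_Λ_eq_empty)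

variable {F : T4Family} {N : ℕ} {𝔸 : Type*} [NormedRing 𝔸] [NormedAlgebra ℂ 𝔸] [CompleteSpace 𝔸]

/-! ## §1  The clause of `BgProvisoΛ` at a dead ∕ switch ∕ all-small level -/

section Clause

/-- `∅^{∼n} = ∅` on the torus. [cite: Balaban1988Convergent, (2.1)–(2.3) pp.254–255 (bookkeeping)] -/
theorem enlT_empty (P : Params) (s n : ℕ) : Node00.Sect2.enlT P s n (∅ : Set (Site P 0)) = ∅ := by
  ext y
  simp only [Node00.Sect2.mem_enlT_iff, Set.preimage_empty, Set.mem_empty_iff_false, iff_false, not_exists, not_and]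
  rintro x ⟨z, hz, -⟩
  exact hz.elim

/-- A non-empty set meets `T^{∼n} = T`. [cite: Balaban1987RG1, p.257 (X ⊂ X̃ⁿ; bookkeeping)] -/
theorem inter_enlT_univ_nonempty (P : Params) (s n : ℕ) {Y : Set (Site P 0)} (hY : Y.Nonempty) :
    (Y ∩ Node00.Sect2.enlT P s n (Set.univ : Set (Site P 0))).Nonempty := by
  obtain ⟨y, hy⟩ := hY
  exact ⟨y, hy, Node00.Sect2.subset_enlT s n _ (Set.mem_univ y)⟩

variable {K : ℕ} (S : Sect2.Setting 𝔸 (SU N)) (Rz : Sect2.Residual (F.P K) 𝔸) {ν : Stage7Numerics} {M : ℕ} {g : ℕ → ℝ} {n : ℕ}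

/-- **★★ AT A DEAD LEVEL THE CLAUSE IS FREE**: if `Ω_j(s) = ∅` and `Λ_j(s) = ∅` then, for every background `U`, every scale `j` and every localization domain `X ∈ 𝐃_j` (`M ≥ 1`, so
`X` has a site — dag-n21-c), both ranged antecedents fail: the per-`(s, U, j, X)` clause of `BgProvisoΛ` holds. [cite: Balaban1988Convergent, (2.27)–(2.28) p.259, (2.41)(i) p.261] -/
theorem bgClause_of_dead (hM : 1 ≤ M) (s : SeqOfRecord F ν M g K n) {j : ℕ} (hΩ : s.Ω j = ∅) (hΛ : s.Λ j = ∅)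
    (U : GaugeField (F.P K) 0 (SU N)) (X : (Sect2.domSys (F.P K) M j).Dom) :
    (Sect2.domSites (F.P K) M j X ⊆ s.Λ j →
      Sect2.ofBackgroundC S.ι U ∈ Sect2.spaceI S Rz M j (Sect2.domSites (F.P K) M j X) (S.lf.alpha0 (S.flow.g j)) (S.lf.alpha1 (S.flow.g j))) ∧
    (Sect2.admB (F.P K) ν M g s.Ω s.Λ j (Sect2.domSites (F.P K) M j X) = true →
      Sect2.ofBackgroundC S.ι U ∈ Sect2.spaceMS S Rz M j (Sect2.domSites (F.P K) M j X) s.Ω) := by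
  refine ⟨fun hX => ?_, fun hB => ?_⟩
  · obtain ⟨y, hy⟩ := domSites_nonempty hM j X
    have := hX hy
    rw [hΛ] at this
    exact this.elim
  · rw [Sect2.admB_eq_true_iff] at hB
    obtain ⟨⟨y, hy⟩, -⟩ := hB
    rw [hΩ, Set.inter_empty] at hy
    exact hy.elim

/-- **★★ AT THE SWITCH LEVEL THE CLAUSE IS THE `spaceMS`-MEMBERSHIP**: if `Ω_j(s) = T` and `Λ_j(s) = ∅` then the `spaceI` half is free and the (2.41)(i) range holds for EVERY domain
(`X ∩ T ≠ ∅`, `Z̃_j = (∅ᶜ)^∼ = T`), so the clause is exactly `U ∈ spaceMS(X, Ω(s))`. [cite: Balaban1988Convergent, (2.41)(i) p.261, (2.27)–(2.28) p.259] -/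
theorem bgClause_iff_spaceMS_of_switch (hM : 1 ≤ M) (s : SeqOfRecord F ν M g K n) {j : ℕ} (hΩ : s.Ω j = Set.univ) (hΛ : s.Λ j = ∅)
    (U : GaugeField (F.P K) 0 (SU N)) (X : (Sect2.domSys (F.P K) M j).Dom) :
    ((Sect2.domSites (F.P K) M j X ⊆ s.Λ j →
        Sect2.ofBackgroundC S.ι U ∈ Sect2.spaceI S Rz M j (Sect2.domSites (F.P K) M j X) (S.lf.alpha0 (S.flow.g j)) (S.lf.alpha1 (S.flow.g j))) ∧
      (Sect2.admB (F.P K) ν M g s.Ω s.Λ j (Sect2.domSites (F.P K) M j X) = true →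
        Sect2.ofBackgroundC S.ι U ∈ Sect2.spaceMS S Rz M j (Sect2.domSites (F.P K) M j X) s.Ω)) ↔
      Sect2.ofBackgroundC S.ι U ∈ Sect2.spaceMS S Rz M j (Sect2.domSites (F.P K) M j X) s.Ω := by
  have hadm : Sect2.admB (F.P K) ν M g s.Ω s.Λ j (Sect2.domSites (F.P K) M j X) = true := by
    rw [Sect2.admB_eq_true_iff, hΩ, hΛ, Set.inter_univ, Set.compl_empty]
    exact ⟨domSites_nonempty hM j X, inter_enlT_univ_nonempty _ _ _ (domSites_nonempty hM j X)⟩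
  refine ⟨fun h => h.2 hadm, fun h => ⟨fun hX => ?_, fun _ => h⟩⟩
  obtain ⟨y, hy⟩ := domSites_nonempty hM j X
  have := hX hy
  rw [hΛ] at this
  exact this.elim

/-- **★★ AT AN ALL-SMALL LEVEL THE CLAUSE IS THE `spaceI`-MEMBERSHIP**: if `Λ_j(s) = T` then the (2.41)(i) range is empty (`Z̃_j = ∅^∼ = ∅`) and every domain lies in `Λ_j`, so
the clause is exactly `U ∈ spaceI(X)` — regularity with local gauges on EVERY localization domain of the torus (the global small-field background).
[cite: Balaban1988Convergent, (2.27)–(2.28) p.259; Balaban1987RG1, (1.11)–(1.16) pp.261–262] -/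
theorem bgClause_iff_spaceI_of_allSmall (s : SeqOfRecord F ν M g K n) {j : ℕ} (hΛ : s.Λ j = Set.univ)
    (U : GaugeField (F.P K) 0 (SU N)) (X : (Sect2.domSys (F.P K) M j).Dom) :
    ((Sect2.domSites (F.P K) M j X ⊆ s.Λ j →
        Sect2.ofBackgroundC S.ι U ∈ Sect2.spaceI S Rz M j (Sect2.domSites (F.P K) M j X) (S.lf.alpha0 (S.flow.g j)) (S.lf.alpha1 (S.flow.g j))) ∧
      (Sect2.admB (F.P K) ν M g s.Ω s.Λ j (Sect2.domSites (F.P K) M j X) = true →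
        Sect2.ofBackgroundC S.ι U ∈ Sect2.spaceMS S Rz M j (Sect2.domSites (F.P K) M j X) s.Ω)) ↔
      Sect2.ofBackgroundC S.ι U ∈ Sect2.spaceI S Rz M j (Sect2.domSites (F.P K) M j X) (S.lf.alpha0 (S.flow.g j)) (S.lf.alpha1 (S.flow.g j)) := by
  refine ⟨fun h => h.1 (by rw [hΛ]; exact Set.subset_univ _), fun h => ⟨fun _ => h, fun hB => ?_⟩⟩
  rw [Sect2.admB_eq_true_iff, hΛ, Set.compl_univ, enlT_empty, Set.inter_empty] at hB
  exact absurd hB.2 Set.not_nonempty_empty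

end Clause

/-! ## §2  The token splits level-wise; on a one-block tail it is two suppliers -/

section Token

variable {K : ℕ} {S : Sect2.Setting 𝔸 (SU N)} {Rz : Sect2.Residual (F.P K) 𝔸} {ν : Stage7Numerics} {M : ℕ} {g : ℕ → ℝ} {n : ℕ}
  {Supp : SeqOfRecord F ν M g K n → Set (B15DeterminingSets.MSField (F.P K) (SU N))} {U : SeqOfRecord F ν M g K n → BgMap F N K}

/-- **THE TOKEN SPLITS LEVEL-WISE**: for `n₀ ≤ k`, `BgProvisoΛ … k` ⟺ `BgProvisoΛ … n₀` ∧ the clauses at the levels `n₀ < j ≤ k`. [cite: Balaban1988Convergent, (2.28) p.259 (bookkeeping)] -/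
theorem bgProvisoΛ_iff_prefix_and_tail {k n₀ : ℕ} (hn₀ : n₀ ≤ k) :
    BgProvisoΛ F N K S Rz M k Supp U ↔
      BgProvisoΛ F N K S Rz M n₀ Supp U ∧
        ∀ s W, W ∈ Supp s → ∀ j, n₀ < j → j ≤ k → ∀ X : (Sect2.domSys (F.P K) M j).Dom,
          (Sect2.domSites (F.P K) M j X ⊆ s.Λ j →
            Sect2.ofBackgroundC S.ι (U s W) ∈ Sect2.spaceI S Rz M j (Sect2.domSites (F.P K) M j X) (S.lf.alpha0 (S.flow.g j)) (S.lf.alpha1 (S.flow.g j))) ∧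
          (Sect2.admB (F.P K) ν M g s.Ω s.Λ j (Sect2.domSites (F.P K) M j X) = true →
            Sect2.ofBackgroundC S.ι (U s W) ∈ Sect2.spaceMS S Rz M j (Sect2.domSites (F.P K) M j X) s.Ω) :=
  ⟨fun h => ⟨h.of_le hn₀, fun s W hW j hj hjk X => h s W hW j (by omega) hjk X⟩,
    fun ⟨hpre, htail⟩ s W hW j h1 hj X => by
      by_cases hjn : j ≤ n₀
      · exact hpre s W hW j h1 hjn X
      · exact htail s W hW j (by omega) hj X⟩

/-- **★★★ ON A ONE-BLOCK TAIL THE TOKEN IS TWO SUPPLIERS**: `BgProvisoΛ … k Supp U` follows from (i) the token up to `n₀ ≤ k`, (ii) the levels `n₀ < j ≤ k` being ONE-BLOCK (the 𝐃_j-cube of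
record exceeds the torus), (iii) an ALL-SMALL supplier — `Λ_j(s) = T ⇒ U(s,𝐖) ∈ spaceI(X)` for every domain — and (iv) a SWITCH supplier — `Ω_j(s) = T`, `Λ_j(s) = ∅ ⇒ U(s,𝐖) ∈
spaceMS(X, Ω(s))`; the dead levels `(∅, ∅)` cost nothing (`M ≥ 1`).  On the tail levels this is what dag-n11-w1's one-block producer `hob` has to deliver, and no more (its prefix-level
clauses for the same family are `hpre`).
[cite: Balaban1988Convergent, (2.27)–(2.28) p.259, (2.41)(i) p.261, (2.1)–(2.3) pp.254–255, (2.17) p.257] -/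
theorem bgProvisoΛ_of_prefix_of_oneBlockTail (hM : 1 ≤ M) {k n₀ : ℕ} (hn₀ : n₀ ≤ k) (hpre : BgProvisoΛ F N K S Rz M n₀ Supp U)
    (hone : ∀ j, n₀ < j → j ≤ k → (F.P K).sitesPerDir 0 ≤ dCubeSide (F.P K).L M (RkOfRecord (F.P K).L ν.r (g j)) j)
    (hI : ∀ s W, W ∈ Supp s → ∀ j, n₀ < j → j ≤ k → s.Λ j = Set.univ → ∀ X : (Sect2.domSys (F.P K) M j).Dom,
      Sect2.ofBackgroundC S.ι (U s W) ∈ Sect2.spaceI S Rz M j (Sect2.domSites (F.P K) M j X) (S.lf.alpha0 (S.flow.g j)) (S.lf.alpha1 (S.flow.g j)))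
    (hMS : ∀ s W, W ∈ Supp s → ∀ j, n₀ < j → j ≤ k → s.Ω j = Set.univ → s.Λ j = ∅ → ∀ X : (Sect2.domSys (F.P K) M j).Dom,
      Sect2.ofBackgroundC S.ι (U s W) ∈ Sect2.spaceMS S Rz M j (Sect2.domSites (F.P K) M j X) s.Ω) :
    BgProvisoΛ F N K S Rz M k Supp U := by
  refine (bgProvisoΛ_iff_prefix_and_tail hn₀).2 ⟨hpre, fun s W hW j hj hjk X => ?_⟩
  by_cases hw : 1 ≤ j ∧ j ≤ n
  · -- inside the history's window: the level is one-block, so `Ω_j, Λ_j ∈ {∅, T}`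
    rcases eq_empty_or_eq_univ_of_mem_unionsOfCubes_of_le (hone j hj hjk) (s.chain.memΛ j hw.1 hw.2) with hΛ | hΛ
    · rcases eq_empty_or_eq_univ_of_mem_unionsOfCubes_of_le (hone j hj hjk) (s.chain.memΩ j hw.1 hw.2) with hΩ | hΩ
      · exact bgClause_of_dead S Rz hM s hΩ hΛ (U s W) X
      · exact (bgClause_iff_spaceMS_of_switch S Rz hM s hΩ hΛ (U s W) X).2 (hMS s W hW j hj hjk hΩ hΛ X)
    · exact (bgClause_iff_spaceI_of_allSmall S Rz s hΛ (U s W) X).2 (hI s W hW j hj hjk hΛ X)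
  · -- off the window both regions vanish
    exact bgClause_of_dead S Rz hM s (s.Ω_off j hw) (s.Λ_off j hw) (U s W) X

/-- **★★★ THE SAME WITH THE SUPPLIERS TOLD THE WHOLE STAIRCASE**: on the one-block tail the all-small supplier at level `j` is only ever asked at histories that are ALL-SMALL AT EVERY
LEVEL `1 ≤ i ≤ j` (prefix levels `≤ n₀` included — `Λ_j = T` propagates down the (2.1)-chain), and the switch supplier at level `j` only at histories all-small below `j`, `(T, ∅)` at `j`
and DEAD at every later level — ONE history shape per `(j, n)`.  So `hob` meets the global small-field background of the all-small history and nothing else.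
[cite: Balaban1988Convergent, (2.1)–(2.3) pp.254–255, (2.27)–(2.28) p.259, (2.41)(i) p.261, (2.17) p.257] -/
theorem bgProvisoΛ_of_prefix_of_oneBlockTail' (hM : 1 ≤ M) {k n₀ : ℕ} (hn₀ : n₀ ≤ k) (hpre : BgProvisoΛ F N K S Rz M n₀ Supp U)
    (hone : ∀ j, n₀ < j → j ≤ k → (F.P K).sitesPerDir 0 ≤ dCubeSide (F.P K).L M (RkOfRecord (F.P K).L ν.r (g j)) j)
    (hI : ∀ s W, W ∈ Supp s → ∀ j, n₀ < j → j ≤ k → j ≤ n → (∀ i, 1 ≤ i → i ≤ j → s.Ω i = Set.univ ∧ s.Λ i = Set.univ) →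
      ∀ X : (Sect2.domSys (F.P K) M j).Dom,
        Sect2.ofBackgroundC S.ι (U s W) ∈ Sect2.spaceI S Rz M j (Sect2.domSites (F.P K) M j X) (S.lf.alpha0 (S.flow.g j)) (S.lf.alpha1 (S.flow.g j)))
    (hMS : ∀ s W, W ∈ Supp s → ∀ j, n₀ < j → j ≤ k → j ≤ n → (∀ i, 1 ≤ i → i < j → s.Ω i = Set.univ ∧ s.Λ i = Set.univ) →
      s.Ω j = Set.univ → s.Λ j = ∅ → (∀ i, j < i → i ≤ n → s.Ω i = ∅ ∧ s.Λ i = ∅) → ∀ X : (Sect2.domSys (F.P K) M j).Dom,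
        Sect2.ofBackgroundC S.ι (U s W) ∈ Sect2.spaceMS S Rz M j (Sect2.domSites (F.P K) M j X) s.Ω) :
    BgProvisoΛ F N K S Rz M k Supp U := by
  refine (bgProvisoΛ_iff_prefix_and_tail hn₀).2 ⟨hpre, fun s W hW j hj hjk X => ?_⟩
  by_cases hw : 1 ≤ j ∧ j ≤ n
  · rcases eq_empty_or_eq_univ_of_mem_unionsOfCubes_of_le (hone j hj hjk) (s.chain.memΛ j hw.1 hw.2) with hΛ | hΛ
    · rcases eq_empty_or_eq_univ_of_mem_unionsOfCubes_of_le (hone j hj hjk) (s.chain.memΩ j hw.1 hw.2) with hΩ | hΩ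
      · exact bgClause_of_dead S Rz hM s hΩ hΛ (U s W) X
      · refine (bgClause_iff_spaceMS_of_switch S Rz hM s hΩ hΛ (U s W) X).2 (hMS s W hW j hj hjk hw.2 (fun i hi1 hij => ?_) hΩ hΛ
          (fun i hji hi => dead_above_of_Λ_eq_empty s hw.1 hΛ hji hi) X)
        -- below the switch level everything is small: `Ω_j = T ⊆ Λ_{j−1}`
        obtain ⟨j', rfl⟩ : ∃ j', j = j' + 1 := ⟨j - 1, by omega⟩
        have hsub : s.Ω (j' + 1) ⊆ s.Λ j' := s.chain.Ω_succ_subset j' (by omega) (Nat.lt_of_lt_of_le (Nat.lt_succ_self j') hw.2)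
        rw [hΩ] at hsub
        exact allSmall_below_of_Λ_eq_univ s (by omega) (Set.eq_univ_of_univ_subset hsub) hi1 (by omega)
    · exact (bgClause_iff_spaceI_of_allSmall S Rz s hΛ (U s W) X).2 (hI s W hW j hj hjk hw.2 (fun i hi1 hij => allSmall_below_of_Λ_eq_univ s hw.2 hΛ hi1 hij) X)
  · exact bgClause_of_dead S Rz hM s (s.Ω_off j hw) (s.Λ_off j hw) (U s W) X

/-- Dead top: the `Ω`-sequences of `s` and of `init s` agree at every index. [cite: Balaban1988Convergent, (2.1) p.254 (bookkeeping)] -/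
private theorem Ω_eq_init_of_dead {n : ℕ} (s : SeqOfRecord F ν M g K (n + 1)) (hΩ : s.Ω (n + 1) = ∅) : s.Ω = s.init.Ω := by
  funext j
  by_cases hj : j ≤ n
  · by_cases h1 : 1 ≤ j
    · exact (Seq.init_Ω s h1 hj).symm
    · rw [s.Ω_off j (fun h => h1 h.1), s.init.Ω_off j (fun h => h1 h.1)]
  · by_cases hj1 : j = n + 1
    · subst hj1; rw [hΩ, s.init.Ω_off (n + 1) (by omega)]
    · rw [s.Ω_off j (by omega), s.init.Ω_off j (by omega)]

/-- Dead top: the `Λ`-sequences of `s` and of `init s` agree at every index (`Λ_{n+1} ⊆ Ω_{n+1} = ∅`). [cite: Balaban1988Convergent, (2.1) p.254 (bookkeeping)] -/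
private theorem Λ_eq_init_of_dead {n : ℕ} (s : SeqOfRecord F ν M g K (n + 1)) (hΩ : s.Ω (n + 1) = ∅) : s.Λ = s.init.Λ := by
  funext j
  by_cases hj : j ≤ n
  · by_cases h1 : 1 ≤ j
    · exact (Seq.init_Λ s h1 hj).symm
    · rw [s.Λ_off j (fun h => h1 h.1), s.init.Λ_off j (fun h => h1 h.1)]
  · by_cases hj1 : j = n + 1
    · subst hj1
      have hsub : s.Λ (n + 1) ⊆ s.Ω (n + 1) := s.chain.Λ_subset (n + 1) (by omega) le_rfl
      rw [hΩ] at hsub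
      rw [Set.eq_empty_of_subset_empty hsub, s.init.Λ_off (n + 1) (by omega)]
    · rw [s.Λ_off j (by omega), s.init.Λ_off j (by omega)]

/-- **★★ THE PREFIX CLAUSES ALONG A DEAD CONTINUATION COME FROM THE SHORTER FAMILY**: if a history `s` of length `n+1` is dead at its top (`Ω_{n+1}(s) = ∅`), its background is the
background of `init s` (`U s = U′ (init s)` — at the record def-R's `UbgOfRecord₁₃CoP_succ_eq_init_of_Omega_empty`, dag-n11-d) and its support set lies in that of `init s`, then EVERY clause
of the length-`(n+1)` token at `s` (any level `1 ≤ j ≤ k`) follows from the token of the length-`n` family — so below the floor the prefix-level clauses of the long dead-tailed histories are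
print's clauses of their live truncations. [cite: Balaban1988Convergent, (2.12)–(2.13) pp.256–257, (2.27)–(2.28) p.259, (2.41)(i) p.261] -/
theorem bgClause_of_init_of_dead {n k : ℕ}
    {Supp : SeqOfRecord F ν M g K (n + 1) → Set (B15DeterminingSets.MSField (F.P K) (SU N))} {U : SeqOfRecord F ν M g K (n + 1) → BgMap F N K}
    {Supp' : SeqOfRecord F ν M g K n → Set (B15DeterminingSets.MSField (F.P K) (SU N))} {U' : SeqOfRecord F ν M g K n → BgMap F N K}
    (h : BgProvisoΛ F N K S Rz M k Supp' U') (s : SeqOfRecord F ν M g K (n + 1)) (hΩ : s.Ω (n + 1) = ∅)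
    (hU : U s = U' s.init) (hSupp : Supp s ⊆ Supp' s.init) {W : B15DeterminingSets.MSField (F.P K) (SU N)} (hW : W ∈ Supp s)
    {j : ℕ} (h1 : 1 ≤ j) (hj : j ≤ k) (X : (Sect2.domSys (F.P K) M j).Dom) :
    (Sect2.domSites (F.P K) M j X ⊆ s.Λ j →
      Sect2.ofBackgroundC S.ι (U s W) ∈ Sect2.spaceI S Rz M j (Sect2.domSites (F.P K) M j X) (S.lf.alpha0 (S.flow.g j)) (S.lf.alpha1 (S.flow.g j))) ∧
    (Sect2.admB (F.P K) ν M g s.Ω s.Λ j (Sect2.domSites (F.P K) M j X) = true →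
      Sect2.ofBackgroundC S.ι (U s W) ∈ Sect2.spaceMS S Rz M j (Sect2.domSites (F.P K) M j X) s.Ω) := by
  rw [hU, Ω_eq_init_of_dead s hΩ, Λ_eq_init_of_dead s hΩ]
  exact h s.init W (hSupp hW) j h1 hj X

/-- **★★ CONVERSELY THE TOKEN CONTAINS THE ALL-SMALL SUPPLIER**: at an all-small level `1 ≤ j ≤ k` (`Λ_j(s) = T`) the token gives `U(s,𝐖) ∈ spaceI(X)` for every domain.
[cite: Balaban1988Convergent, (2.27)–(2.28) p.259] -/
theorem spaceI_of_bgProvisoΛ_of_allSmall {k : ℕ} (h : BgProvisoΛ F N K S Rz M k Supp U) (s : SeqOfRecord F ν M g K n)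
    {W : B15DeterminingSets.MSField (F.P K) (SU N)} (hW : W ∈ Supp s) {j : ℕ} (h1 : 1 ≤ j) (hj : j ≤ k) (hΛ : s.Λ j = Set.univ)
    (X : (Sect2.domSys (F.P K) M j).Dom) :
    Sect2.ofBackgroundC S.ι (U s W) ∈ Sect2.spaceI S Rz M j (Sect2.domSites (F.P K) M j X) (S.lf.alpha0 (S.flow.g j)) (S.lf.alpha1 (S.flow.g j)) :=
  (bgClause_iff_spaceI_of_allSmall S Rz s hΛ (U s W) X).1 (h s W hW j h1 hj X)

/-- **★★ … AND THE SWITCH SUPPLIER**: at a switch level `1 ≤ j ≤ k` (`Ω_j(s) = T`, `Λ_j(s) = ∅`; `M ≥ 1`) the token gives `U(s,𝐖) ∈ spaceMS(X, Ω(s))` for every domain.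
[cite: Balaban1988Convergent, (2.41)(i) p.261, (2.28) p.259] -/
theorem spaceMS_of_bgProvisoΛ_of_switch (hM : 1 ≤ M) {k : ℕ} (h : BgProvisoΛ F N K S Rz M k Supp U) (s : SeqOfRecord F ν M g K n)
    {W : B15DeterminingSets.MSField (F.P K) (SU N)} (hW : W ∈ Supp s) {j : ℕ} (h1 : 1 ≤ j) (hj : j ≤ k) (hΩ : s.Ω j = Set.univ) (hΛ : s.Λ j = ∅)
    (X : (Sect2.domSys (F.P K) M j).Dom) :
    Sect2.ofBackgroundC S.ι (U s W) ∈ Sect2.spaceMS S Rz M j (Sect2.domSites (F.P K) M j X) s.Ω :=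
  (bgClause_iff_spaceMS_of_switch S Rz hM s hΩ hΛ (U s W) X).1 (h s W hW j h1 hj X)

end Token

/-! ## §3  Along a windowed (2.6)-run: the prefix token up to p633302's `n₀` and the two tail suppliers -/

section Run

variable [NeZero N] {S : Sect2.Setting 𝔸 (SU N)}

/-- **★★★ `BgProvisoΛ` UP TO ANY `k ≤ K` ALONG A (2.6)-RUN FROM THE PREFIX TOKEN AND THE TWO TAIL SUPPLIERS** (generic θ, `θ.τ9.M = F.L^a`, `θ.ν.r = 1`, window `]0, γ]`, (2.6) with
`0 ≤ β⁺`, `β⁺·γ² ≤ 1`; histories over the run's `𝐃` of record, any length `n`): with `n₀` = p633302's last compatible level, the token up to `min n₀ k` plus the all-small and switch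
suppliers on `n₀ < j ≤ k` give the token up to `k`.  (`1 ≤ M` from `M = L^a`.) [cite: Balaban1988Convergent, (2.6) p.255, (2.27)–(2.28) p.259, (2.41)(i) p.261, p.257; Balaban1987RG1, (0.1) p.251] -/
theorem bgProvisoΛ_of_prefix_of_suppliers_of_flowIneq26 (θ : Stage13Params F N) {a : ℕ} (hMa : θ.τ9.M = F.L ^ a) (hr : θ.ν.r = 1)
    (p : B12.RunParams) {γ βup β₀ : ℝ} (hβ : 0 ≤ βup) (hβγ : βup * γ ^ 2 ≤ 1)
    (hW : Step.InInterval γ p.K (gOfRecord₁₃ F N θ p))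
    (h26 : B14.FlowIneq26 (gOfRecord₁₃ F N θ p) βup β₀ p.K)
    {Rz : Sect2.Residual (F.P p.K) 𝔸} {n : ℕ}
    {Supp : SeqOfRecord F θ.ν θ.τ9.M (gOfRecord₁₃ F N θ p) p.K n → Set (B15DeterminingSets.MSField (F.P p.K) (SU N))}
    {U : SeqOfRecord F θ.ν θ.τ9.M (gOfRecord₁₃ F N θ p) p.K n → BgMap F N p.K} {k : ℕ} (hk : k ≤ p.K)
    (hsplit : ∀ n₀, n₀ ≤ p.K → PartCompat₁₃ F N θ p n₀ →
      (∀ j, n₀ < j → j ≤ p.K → (F.P p.K).sitesPerDir 0 < dCubeSide (F.P p.K).L θ.τ9.M (RkOfRecord (F.P p.K).L θ.ν.r (gOfRecord₁₃ F N θ p j)) j) →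
      BgProvisoΛ F N p.K S Rz θ.τ9.M (min n₀ k) Supp U ∧
      (∀ s W, W ∈ Supp s → ∀ j, n₀ < j → j ≤ k → s.Λ j = Set.univ → ∀ X : (Sect2.domSys (F.P p.K) θ.τ9.M j).Dom,
        Sect2.ofBackgroundC S.ι (U s W) ∈ Sect2.spaceI S Rz θ.τ9.M j (Sect2.domSites (F.P p.K) θ.τ9.M j X) (S.lf.alpha0 (S.flow.g j)) (S.lf.alpha1 (S.flow.g j))) ∧
      (∀ s W, W ∈ Supp s → ∀ j, n₀ < j → j ≤ k → s.Ω j = Set.univ → s.Λ j = ∅ → ∀ X : (Sect2.domSys (F.P p.K) θ.τ9.M j).Dom,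
        Sect2.ofBackgroundC S.ι (U s W) ∈ Sect2.spaceMS S Rz θ.τ9.M j (Sect2.domSites (F.P p.K) θ.τ9.M j X) s.Ω)) :
    BgProvisoΛ F N p.K S Rz θ.τ9.M k Supp U := by
  have hM : 1 ≤ θ.τ9.M := by rw [hMa]; exact Nat.one_le_pow _ _ (by have := F.hL11; omega)
  obtain ⟨n₀, hn₀, hPC, htail⟩ := exists_lastCompatibleLevel_of_window_of_flowIneq26 θ hMa hr p hβ hβγ hW h26
  obtain ⟨hpre, hI, hMS⟩ := hsplit n₀ hn₀ hPC htail
  by_cases hkn : k ≤ n₀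
  · rw [min_eq_right hkn] at hpre
    exact hpre
  · rw [min_eq_left (by omega)] at hpre
    exact bgProvisoΛ_of_prefix_of_oneBlockTail hM (by omega) hpre (fun j hj hjk => (htail j hj (hjk.trans hk)).le) hI hMS

end Run

end Summit.QuantumFields.YangMills.Theorems.BalabanUVNodesN11BgProvisoOnOneBlockTail

end
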